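import Literature.MathematicalPhysics.KineticTheory.CollisionFluxUpperBound
import Literature.MathematicalPhysics.KineticTheory.HardSphereCanonicalPairBound
import Literature.MathematicalPhysics.KineticTheory.CollisionTubePullbackDefs
import Summits.AtomisticToContinuum.HydrodynamicLimit.Theorems.JParityClosureCollisionTightnessTorusGibbs
import Summits.AtomisticToContinuum.HydrodynamicLimit.Theorems.JParityClosureKineticEnergyTailsApriori
import HarnessLib

/-!
# Crux `JParityClosure.EvenStressEnskog` (stmt-AtomisticToContinuum-13079), line
# `even-rung-mean-variance`: three-body window statics for `stub_threeBodyCollisionSumRung0`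

Helper file (`--supports stmt-AtomisticToContinuum-13079`; registered helper
`localGibbsLaw_window_shell_le`).  The three-body collision-sum residual `N₃` of the collision-cylinder
pull-back ((S2b₃) of the line) counts, at every collision `(s, p, q)` of the orbit, the third particles
in the near-contact shell `ε < ‖x_l − x_p‖ ≤ ε(1 + 2Lκ)` of `p`.  Its control at rung 0 (homogeneous
Gibbs law) runs through the window bound `measure_collisionSum_ge_le_liminf` of
`Literature/…/CollisionFluxUpperBound` with a mark of the CONFIGURATION (not of the velocities), which
needs two inputs supplied here:

* `ofReal_shellCount_freeFlight_le` — the MAJORANT of the mark along a backward free flight of duration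
  `t ≤ h` ending at contact of `(i, j)`: the shell count of `i` is at most the number of labels
  `l ∉ {i, j}` with `ε ≤ dist(x_l, x_i) ≤ ε(1 + 2Lκ) + h ‖v_i − v_l‖` (the partner `j` is AT contact, hence
  not in the open shell; the others move by at most `h ‖v_i − v_l‖` relative to `i`,
  `Torus.euclidDist_le_euclidDist_translate`; the lower bound is the hard core);
* `localGibbsLaw_window_shell_le` — the STATIC three-label bound: under the rung-0 law
  `posGibbs ⊗ N(u,θ)^{⊗(N+1)}` (`localGibbsMeasure_rung0_eq_map`) the probability that a lift of
  `x_j − x_i` lies in the swept tube of `v_i − v_j` (volume `≤ 4ε²h‖v_i − v_j‖`) and `x_l` in the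
  thickened shell of `x_i` is at most `32 ε² h (1 + 4(‖u‖² + 3θ)) ((28π/3) x ε³ + 5h)` (`x = 2Lκ`), given the
  Ruelle-type three-label bound `≤ 8 vol · vol'` of the canonical law (`posGibbs_tripleEvent_le` of
  `HardSphereCanonicalClusterBound`, taken as the hypothesis `htriple`): the Haar volume of the thickened
  shell is `≤ (28π/3) x ε³ + 5d` (`volume_shell_le`: `(4π/3)((ε(1+x)+d)³ − ε³)` inside the injectivity
  radius, total mass `1 ≤ 5d` beyond), and the velocity weights `‖v_i − v_j‖`, `‖v_i − v_j‖‖v_i − v_l‖`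
  are dominated by `1 + 2‖v_i‖² + ‖v_j‖² + ‖v_l‖²`, of Maxwellian mean `1 + 4(‖u‖² + 3θ)`
  (`lintegral_velWeight_pi_gaussMeasure`).

Summed over the `(N+1)³` label triples and the `M` windows of mesh `h = τ/M`, the main term is
`∝ (N+1)³ ε⁵ τ L κ`, i.e. `∝ σ⁶ τ L κ / η` after the Markov normalisation `ε/(η(N+1))`, and the thickening
error is `O(1/M)`, killed by the `liminf` of the window bound (consumer:
`JParityClosureEvenStressEnskogThreeBodyCollisionSumRung0.lean`).

References: C. Cercignani, R. Illner, M. Pulvirenti, *The Mathematical Theory of Dilute Gases* (1994),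
App. 4.A; I. Gallagher, L. Saint-Raymond, B. Texier, *From Newton to Boltzmann* (2013), Prop. 4.1.1;
D. Ruelle, *Statistical Mechanics: Rigorous Results* (1969), §4.2.
-/

noncomputable section

open MeasureTheory Set Filter Topology Metric
open scoped ENNReal InnerProductSpace BigOperators

namespace Summit.AtomisticToContinuum.HydrodynamicLimit.Theorems.EvenStressEnskog

open Literature.Analysis.FluidPDE Literature.MathematicalPhysics.KineticTheory
open Literature.Analysis.FunctionSpaces

/-! ### The shell count along a backward free flight -/

/-- Along a backward free flight of duration `t` the minimal-image distance of two particles changes by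
at most `|t| ‖vᵢ − v_l‖`: `‖sepAt w i l‖ ≤ ‖sepAt (S_{−t} w) i l‖ + |t| ‖vᵢ − v_l‖`. [folklore] -/
theorem norm_sepAt_le_freeFlight {N : ℕ} (w : Config (N + 1) (Fin 3) T3) (t : ℝ)
    (i l : Fin (N + 1)) :
    ‖sepAt w i l‖ ≤ ‖sepAt (freeFlight (Torus.geometry (Fin 3)) (-t) w) i l‖ +
      |t| * ‖(w i).2 - (w l).2‖ := by
  have h := Torus.euclidDist_le_euclidDist_translate (w i).1 (w l).1 ((-t) • (w i).2)
    ((-t) • (w l).2)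
  have hn : ‖(-t) • (w i).2 - (-t) • (w l).2‖ = |t| * ‖(w i).2 - (w l).2‖ := by
    rw [← smul_sub, norm_smul, Real.norm_eq_abs, abs_neg]
  rw [hn] at h
  simpa only [sepAt, Torus.norm_geometry_sepVec, freeFlight_apply, Torus.geometry_translate] using h

/-- The shell count is nonnegative. [folklore] -/
theorem shellCount_nonneg {σ : ℝ} {N : ℕ} (L κ : ℝ) (ζ : Config (N + 1) (Fin 3) T3)
    (p : Fin (N + 1)) :
    0 ≤ shellCount σ N L κ ζ p :=
  Finset.sum_nonneg fun l _ => shellInd_nonneg L κ ζ p l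

/-- **The window majorant of the three-body mark.** If `w` does not overlap, `t ∈ [0, h]` and the
pair `(i, j)` of `S_{−t} w` is at contact, then the number of particles in the near-contact shell
`ε < ‖q‖ ≤ ε(1 + 2Lκ)` of `i` in `S_{−t} w` is at most the number of labels `l ∉ {i, j}` with
`ε ≤ dist(x_l, x_i) ≤ ε(1 + 2Lκ) + h ‖vᵢ − v_l‖` in `w` (the partner `j` is AT contact, not in the
open shell; the others move by at most `h ‖vᵢ − v_l‖` relative to `i`). [folklore] -/
theorem ofReal_shellCount_freeFlight_le {σ : ℝ} (hσ : 0 < σ) {N : ℕ} (L κ : ℝ) {h : ℝ}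
    {w : Config (N + 1) (Fin 3) T3}
    (hw : w ∈ hardSphereDomain (Torus.geometry (Fin 3)) (N + 1) (hsDiameter σ N)) {i j : Fin (N + 1)}
    {t : ℝ} (ht : t ∈ Icc 0 h)
    (hc : ‖(Torus.geometry (Fin 3)).sepVec ((freeFlight (Torus.geometry (Fin 3)) (-t) w i).1)
        ((freeFlight (Torus.geometry (Fin 3)) (-t) w j).1)‖ = hsDiameter σ N) :
    ENNReal.ofReal (shellCount σ N L κ (freeFlight (Torus.geometry (Fin 3)) (-t) w) i) ≤
      ∑ l : Fin (N + 1), if l ≠ i ∧ l ≠ j then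
        {w : Config (N + 1) (Fin 3) T3 | hsDiameter σ N ≤ Torus.euclidDist (w l).1 (w i).1 ∧
          Torus.euclidDist (w l).1 (w i).1 ≤ hsDiameter σ N * (1 + 2 * L * κ) +
            h * ‖(w i).2 - (w l).2‖}.indicator 1 w else 0 := by
  set ζ := freeFlight (Torus.geometry (Fin 3)) (-t) w with hζ
  have hε := hsDiameter_pos hσ N
  unfold shellCount
  rw [ENNReal.ofReal_sum_of_nonneg (fun l _ => shellInd_nonneg L κ ζ i l)]
  refine Finset.sum_le_sum fun l _ => ?_
  unfold shellInd
  by_cases h1 : hsDiameter σ N < ‖sepAt ζ i l‖ ∧ ‖sepAt ζ i l‖ ≤ hsDiameter σ N * (1 + 2 * L * κ)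
  · obtain ⟨hlow, hup⟩ := h1
    have hli : l ≠ i := by
      rintro rfl
      have h0 : ‖sepAt ζ l l‖ = 0 := by
        rw [sepAt, Torus.norm_geometry_sepVec, Torus.euclidDist_self]
      linarith
    have hlj : l ≠ j := by
      rintro rfl
      exact absurd hc (ne_of_gt hlow)
    have hmem : w ∈ {w : Config (N + 1) (Fin 3) T3 |
        hsDiameter σ N ≤ Torus.euclidDist (w l).1 (w i).1 ∧ Torus.euclidDist (w l).1 (w i).1 ≤
          hsDiameter σ N * (1 + 2 * L * κ) + h * ‖(w i).2 - (w l).2‖} := by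
      refine ⟨?_, ?_⟩
      · have h2 := hw i l hli.symm
        rwa [Torus.norm_geometry_sepVec, Torus.euclidDist_comm] at h2
      · have h3 := norm_sepAt_le_freeFlight w t i l
        rw [sepAt, Torus.norm_geometry_sepVec, Torus.euclidDist_comm] at h3
        have h4 : |t| * ‖(w i).2 - (w l).2‖ ≤ h * ‖(w i).2 - (w l).2‖ := by
          rw [abs_of_nonneg ht.1]
          exact mul_le_mul_of_nonneg_right ht.2 (norm_nonneg _)
        linarith
    rw [if_pos ⟨hlow, hup⟩, if_pos ⟨hli, hlj⟩, indicator_of_mem hmem, Pi.one_apply,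
      ENNReal.ofReal_one]
  · rw [if_neg h1, ENNReal.ofReal_zero]
    exact bot_le

/-! ### The Haar volume of a thickened contact shell -/

/-- **Volume of the thickened near-contact shell on `𝕋³`.** For `0 < ε ≤ 1/8`, `0 ≤ x ≤ 1` and
`d ≥ 0`, `vol {p ∈ 𝕋³ | ε ≤ ‖reprSym p‖ ≤ ε(1 + x) + d} ≤ (28π/3) x ε³ + 5 d`: inside the injectivity
radius this is the Euclidean shell volume `(4π/3)((ε(1+x)+d)³ − ε³)` with `(1+x)³ − 1 ≤ 7x` and
`(A + d)³ − A³ ≤ 3 d (A + d)² ≤ 3d/4`; beyond it the total mass `1 ≤ 5d`. [folklore] -/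
theorem volume_shell_le {ε x d : ℝ} (hε : 0 < ε) (hε8 : ε ≤ 1 / 8) (hx0 : 0 ≤ x) (hx1 : x ≤ 1)
    (hd : 0 ≤ d) :
    volume {p : T3 | ε ≤ ‖Torus.reprSym p‖ ∧ ‖Torus.reprSym p‖ ≤ ε * (1 + x) + d} ≤
      ENNReal.ofReal (28 * Real.pi / 3 * x * ε ^ 3) + ENNReal.ofReal (5 * d) := by
  set R : ℝ := ε * (1 + x) + d with hR
  have hεR : ε ≤ R := by rw [hR]; nlinarith
  by_cases hR2 : R < 1 / 2
  · have hset : {p : T3 | ε ≤ ‖Torus.reprSym p‖ ∧ ‖Torus.reprSym p‖ ≤ R} =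
        {p : T3 | Torus.euclidDist p 0 ≤ R} \ {p : T3 | Torus.euclidDist p 0 < ε} := by
      ext p
      simp only [Torus.euclidDist_eq, sub_zero, mem_setOf_eq, Set.mem_sdiff, not_lt, and_comm]
    have hsub : {p : T3 | Torus.euclidDist p 0 < ε} ⊆ {p : T3 | Torus.euclidDist p 0 ≤ R} := by
      intro p hp
      simp only [mem_setOf_eq] at hp ⊢
      linarith
    have hf : Measurable fun p : T3 => Torus.euclidDist p 0 :=
      measurable_torusDist_comp measurable_id measurable_const
    have hmeas : MeasurableSet {p : T3 | Torus.euclidDist p 0 < ε} :=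
      measurableSet_lt hf measurable_const
    have hR0 : 0 ≤ R := hε.le.trans hεR
    have hpi0 := Real.pi_pos.le
    rw [hset, measure_sdiff hsub hmeas.nullMeasurableSet (measure_ne_top _ _),
      Torus.volume_euclidDist_le hR2, Torus.volume_euclidDist_lt (by linarith) (0 : T3),
      EuclideanSpace.volume_closedBall_fin_three, EuclideanSpace.volume_ball_fin_three,
      ← ENNReal.ofReal_pow hR0, ← ENNReal.ofReal_pow hε.le,
      ← ENNReal.ofReal_mul (by positivity), ← ENNReal.ofReal_mul (by positivity),
      ← ENNReal.ofReal_sub _ (by positivity),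
      ← ENNReal.ofReal_add (by positivity) (by positivity)]
    refine ENNReal.ofReal_le_ofReal ?_
    have hA : (1 + x) ^ 3 - 1 ≤ 7 * x := by nlinarith [mul_le_of_le_one_right hx0 hx1, sq_nonneg x]
    have hB : R ^ 3 - (ε * (1 + x)) ^ 3 ≤ d * (3 / 4) := by
      have h1 : R ^ 3 - (ε * (1 + x)) ^ 3 =
          d * (3 * (ε * (1 + x)) ^ 2 + 3 * (ε * (1 + x)) * d + d ^ 2) := by
        rw [hR]; ring
      have h2 : 3 * (ε * (1 + x)) ^ 2 + 3 * (ε * (1 + x)) * d + d ^ 2 ≤ 3 * R ^ 2 := by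
        rw [hR]; nlinarith [mul_nonneg (by positivity : (0 : ℝ) ≤ ε * (1 + x)) hd]
      have h3 : 3 * R ^ 2 ≤ 3 / 4 := by nlinarith
      rw [h1]
      exact mul_le_mul_of_nonneg_left (h2.trans h3) hd
    have hC : (ε * (1 + x)) ^ 3 - ε ^ 3 ≤ 7 * x * ε ^ 3 := by
      have : (ε * (1 + x)) ^ 3 - ε ^ 3 = ε ^ 3 * ((1 + x) ^ 3 - 1) := by ring
      rw [this]
      nlinarith [pow_pos hε 3]
    have hpi := Real.pi_le_four
    nlinarith [mul_nonneg hpi0 hd, mul_nonneg hpi0 (mul_nonneg hx0 (pow_pos hε 3).le)]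
  · have hd4 : 1 / 4 ≤ d := by
      rw [not_lt, hR] at hR2
      nlinarith
    calc volume {p : T3 | ε ≤ ‖Torus.reprSym p‖ ∧ ‖Torus.reprSym p‖ ≤ R}
        ≤ 1 := prob_le_one
      _ = ENNReal.ofReal 1 := ENNReal.ofReal_one.symm
      _ ≤ ENNReal.ofReal (5 * d) := ENNReal.ofReal_le_ofReal (by linarith)
      _ ≤ _ := le_add_self

/-! ### A Gaussian velocity moment -/

/-- The velocity weight `e(v) = 1 + 2‖vᵢ‖² + ‖vⱼ‖² + ‖v_l‖²` of three labels has Maxwellian mean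
`1 + 4(‖u‖² + 3θ)` under `N(u, θ)^{⊗(N+1)}`. [folklore] -/
theorem lintegral_velWeight_pi_gaussMeasure (u : V3) {θ : ℝ} (hθ : 0 < θ) {N : ℕ}
    (i j l : Fin (N + 1)) :
    ∫⁻ v, ENNReal.ofReal (1 + 2 * ‖v i‖ ^ 2 + ‖v j‖ ^ 2 + ‖v l‖ ^ 2)
        ∂(Measure.pi fun _ : Fin (N + 1) => gaussMeasure u θ) =
      ENNReal.ofReal (1 + 4 * (‖u‖ ^ 2 + 3 * θ)) := by
  set γ := gaussMeasure u θ with hγ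
  set Γ : Measure (Fin (N + 1) → V3) := Measure.pi fun _ : Fin (N + 1) => γ with hΓ
  haveI : IsProbabilityMeasure Γ := by rw [hΓ]; infer_instance
  have hm : ∀ k : Fin (N + 1),
      Measurable fun v : Fin (N + 1) → V3 => ENNReal.ofReal (‖v k‖ ^ 2) :=
    fun k => ((measurable_pi_apply k).norm.pow_const 2).ennreal_ofReal
  have hmarg : ∀ k : Fin (N + 1),
      ∫⁻ v, ENNReal.ofReal (‖v k‖ ^ 2) ∂Γ = ENNReal.ofReal (‖u‖ ^ 2 + 3 * θ) := by
    intro k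
    rw [← lintegral_norm_sq_gaussMeasure u hθ]
    exact (measurePreserving_eval (fun _ : Fin (N + 1) => γ) k).lintegral_comp
      (f := fun w : V3 => ENNReal.ofReal (‖w‖ ^ 2)) (by fun_prop)
  have hsplit : ∀ v : Fin (N + 1) → V3,
      ENNReal.ofReal (1 + 2 * ‖v i‖ ^ 2 + ‖v j‖ ^ 2 + ‖v l‖ ^ 2) = 1 + 2 * ENNReal.ofReal (‖v i‖ ^ 2) +
        ENNReal.ofReal (‖v j‖ ^ 2) + ENNReal.ofReal (‖v l‖ ^ 2) := by
    intro v
    rw [ENNReal.ofReal_add (by positivity) (by positivity),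
      ENNReal.ofReal_add (by positivity) (by positivity),
      ENNReal.ofReal_add (by positivity) (by positivity), ENNReal.ofReal_mul (by norm_num),
      ENNReal.ofReal_one, ENNReal.ofReal_ofNat]
  simp_rw [hsplit]
  rw [lintegral_add_right _ (hm l), lintegral_add_right _ (hm j),
    lintegral_add_left measurable_const, lintegral_const_mul _ (hm i), lintegral_const, measure_univ,
    mul_one, hmarg i, hmarg j, hmarg l, ENNReal.ofReal_add zero_le_one (by positivity),
    ENNReal.ofReal_one, ENNReal.ofReal_mul (by norm_num), ENNReal.ofReal_ofNat]
  ring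

/-! ### The static three-label window bound -/

/-- **Static three-label window bound at rung 0.** For `σ ≤ 1/8`, constant profiles `a, θ > 0`, `u`,
a window length `h ≥ 0`, a relative shell width `0 ≤ x ≤ 1`, three distinct labels `i, j, l` whose
canonical three-label law obeys the Ruelle-type bound `htriple` (`posGibbs_tripleEvent_le` at small
reduced density), and a measurable swept-tube family `S` of volume `≤ 4 ε² h ‖u‖` (`hSvol`), the
homogeneous Gibbs probability that a lift of `x_j − x_i` lies in the tube of `v_i − v_j` AND `x_l` lies
in the thickened shell `ε ≤ dist(x_l, x_i) ≤ ε(1 + x) + h ‖v_i − v_l‖` is at most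
`32 ε² h · (1 + 4(‖u‖² + 3θ)) · ((28π/3) x ε³ + 5 h)`: disintegrate the product law
`posGibbs ⊗ N(u,θ)^{⊗(N+1)}` (`localGibbsMeasure_rung0_eq_map`), bound the position event by
`8 · vol(tube) · vol(shell)` (`htriple`, the lift inequality
`volume_setOf_exists_reprSym_add_latticeVec_mem_le`, `volume_shell_le`), and the velocity weights
`‖v_i − v_j‖`, `‖v_i − v_j‖ ‖v_i − v_l‖` by `1 + 2‖v_i‖² + ‖v_j‖² + ‖v_l‖²`
(`lintegral_velWeight_pi_gaussMeasure`). [folklore] -/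
theorem localGibbsLaw_window_shell_le :
    ∀ {σ : ℝ}, 0 < σ → σ ≤ 1 / 2 → σ ≤ 1 / 8 → ∀ {a θ : ℝ}, 0 < a → 0 < θ →
      ∀ (u : V3) {N : ℕ} (Φ : HardSphereFlow (Torus.geometry (Fin 3)) (hsDiameter σ N) (N + 1)) {h : ℝ},
      0 ≤ h → ∀ {x : ℝ}, 0 ≤ x → x ≤ 1 → ∀ {i j l : Fin (N + 1)}, (∀ T T' : Set T3, MeasurableSet T →
      MeasurableSet T' → posGibbsMeasure (fun _ : T3 => (1 : ℝ)) (hsDiameter σ N) (N + 1) {y | y j - y i ∈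
      T ∧ y l - y i ∈ T'} ≤ 8 * (volume T * volume T')) → ∀ {S : V3 → Set V3},
      MeasurableSet {q : V3 × V3 | q.1 ∈ S q.2} → (∀ v, volume (S v) ≤ ENNReal.ofReal (4 * hsDiameter σ N
      ^ 2 * h * ‖v‖)) → localGibbsLaw σ (fun _ => a) (fun _ => u) (fun _ => θ) N Φ ({w | ∃ k : Fin 3 → ℤ,
      Torus.reprSym ((w j).1 - (w i).1) + Literature.Analysis.FunctionSpaces.Torus.latticeVec k ∈ S ((w
      i).2 - (w j).2)} ∩ {w | hsDiameter σ N ≤ Torus.euclidDist (w l).1 (w i).1 ∧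
      Torus.euclidDist (w l).1 (w i).1 ≤ hsDiameter σ N * (1 + x) + h * ‖(w i).2 - (w l).2‖}) ≤
      ENNReal.ofReal (32 * hsDiameter σ N ^ 2 * h) * ENNReal.ofReal (1 + 4 * (‖u‖ ^ 2 + 3 * θ)) *
      (ENNReal.ofReal (28 * Real.pi / 3 * x * hsDiameter σ N ^ 3) + ENNReal.ofReal (5 * h)) := by
  intro σ hσ hσ2 hσ8 a θ ha hθ u N Φ h hh x hx0 hx1 i j l htriple S hSm hSvol
  set ε := hsDiameter σ N with hεdef
  have hε : 0 < ε := hsDiameter_pos hσ N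
  have hε8 : ε ≤ 1 / 8 := (hsDiameter_le hσ.le N).trans hσ8
  set E : Set (Config (N + 1) (Fin 3) T3) := {w | ∃ k : Fin 3 → ℤ,
    Torus.reprSym ((w j).1 - (w i).1) + Literature.Analysis.FunctionSpaces.Torus.latticeVec k ∈
      S ((w i).2 - (w j).2)} with hE
  set D : Set (Config (N + 1) (Fin 3) T3) := {w | ε ≤ Torus.euclidDist (w l).1 (w i).1 ∧
      Torus.euclidDist (w l).1 (w i).1 ≤ ε * (1 + x) + h * ‖(w i).2 - (w l).2‖} with hD
  -- measurability of the two events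
  set ψ : (Fin 3 → ℤ) → Config (N + 1) (Fin 3) T3 → V3 × V3 := fun k w =>
    (Torus.reprSym ((w j).1 - (w i).1) + Torus.latticeVec k, (w i).2 - (w j).2) with hψ
  have hψm : ∀ k, Measurable (ψ k) := fun k =>
    ((Torus.measurable_reprSym.comp
      ((measurable_pi_apply j).fst.sub (measurable_pi_apply i).fst)).add_const _).prodMk
      ((measurable_pi_apply i).snd.sub (measurable_pi_apply j).snd)
  have hEeq : E = ⋃ k, ψ k ⁻¹' {q : V3 × V3 | q.1 ∈ S q.2} := by
    ext w; simp only [hE, hψ, mem_setOf_eq, mem_iUnion, mem_preimage]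
  have hEm : MeasurableSet E := by
    rw [hEeq]; exact MeasurableSet.iUnion fun k => hSm.preimage (hψm k)
  have hdist : Measurable fun w : Config (N + 1) (Fin 3) T3 => Torus.euclidDist (w l).1 (w i).1 :=
    measurable_torusDist_comp (measurable_pi_apply l).fst (measurable_pi_apply i).fst
  have hrad : Measurable fun w : Config (N + 1) (Fin 3) T3 => ε * (1 + x) + h * ‖(w i).2 - (w l).2‖ :=
    measurable_const.add (measurable_const.mul
      ((measurable_pi_apply i).snd.sub (measurable_pi_apply l).snd).norm)
  have hDm : MeasurableSet D :=
    (measurableSet_le measurable_const hdist).inter (measurableSet_le hdist hrad)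
  -- the position sections and their volumes
  have hSu : ∀ v : V3, MeasurableSet (S v) := fun v =>
    hSm.preimage (measurable_id.prodMk measurable_const)
  set T : (Fin (N + 1) → V3) → Set T3 := fun v =>
    {p | ∃ k : Fin 3 → ℤ, Torus.reprSym p + Torus.latticeVec k ∈ S (v i - v j)} with hT
  set T' : (Fin (N + 1) → V3) → Set T3 := fun v =>
    {p | ε ≤ ‖Torus.reprSym p‖ ∧ ‖Torus.reprSym p‖ ≤ ε * (1 + x) + h * ‖v i - v l‖} with hT'
  have hTm : ∀ v, MeasurableSet (T v) := by
    intro v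
    have : T v =
        ⋃ k : Fin 3 → ℤ, (fun p : T3 => Torus.reprSym p + Torus.latticeVec k) ⁻¹' S (v i - v j) := by
      ext p; simp only [hT, mem_setOf_eq, mem_iUnion, mem_preimage]
    rw [this]
    exact MeasurableSet.iUnion fun k => (hSu _).preimage (Torus.measurable_reprSym.add_const _)
  have hT'm : ∀ v, MeasurableSet (T' v) := fun v =>
    (measurableSet_le measurable_const Torus.measurable_reprSym.norm).inter
      (measurableSet_le Torus.measurable_reprSym.norm measurable_const)
  have hlift : ∀ B : Set V3, MeasurableSet B →
      volume {p : T3 | ∃ k : Fin 3 → ℤ, Torus.reprSym p + Torus.latticeVec k ∈ B} ≤ volume B :=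
    fun B hB => by
      simpa only [sub_zero] using volume_setOf_exists_reprSym_add_latticeVec_mem_le (0 : T3) hB
  have hTvol : ∀ v, volume (T v) ≤ ENNReal.ofReal (4 * ε ^ 2 * h * ‖v i - v j‖) := fun v =>
    (hlift _ (hSu (v i - v j))).trans (hSvol _)
  have hT'vol : ∀ v, volume (T' v) ≤
      ENNReal.ofReal (28 * Real.pi / 3 * x * ε ^ 3) + ENNReal.ofReal (5 * (h * ‖v i - v l‖)) :=
    fun v => volume_shell_le hε hε8 hx0 hx1 (by positivity)
  -- the rung-0 law
  set Q := posGibbsMeasure (fun _ : T3 => a) ε (N + 1) with hQ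
  set Γ : Measure (Fin (N + 1) → V3) := Measure.pi fun _ => gaussMeasure u θ with hΓ
  have hlaw :
      localGibbsLaw σ (fun _ => a) (fun _ => u) (fun _ => θ) N Φ = (Q.prod Γ).map zipConfig := by
    rw [localGibbsLaw_eq, localGibbsMeasure_rung0_eq_map σ ha.le hθ u N]
  haveI : IsProbabilityMeasure Q :=
    isProbabilityMeasure_posGibbsMeasure continuous_const (fun _ => ha) hσ2 N
  haveI : IsProbabilityMeasure Γ := by rw [hΓ]; infer_instance
  have hsec : ∀ v : Fin (N + 1) → V3,
      (fun y : Fin (N + 1) → T3 => (y, v)) ⁻¹' (zipConfig ⁻¹' (E ∩ D)) =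
        {y | y j - y i ∈ T v ∧ y l - y i ∈ T' v} := by
    intro v; ext y
    simp only [hE, hD, hT, hT', mem_preimage, mem_inter_iff, mem_setOf_eq, zipConfig_apply,
      Torus.euclidDist_eq]
  -- the bound for fixed velocities
  have hpt : ∀ v : Fin (N + 1) → V3, Q {y | y j - y i ∈ T v ∧ y l - y i ∈ T' v} ≤
      ENNReal.ofReal (32 * ε ^ 2 * h) *
        ENNReal.ofReal (1 + 2 * ‖v i‖ ^ 2 + ‖v j‖ ^ 2 + ‖v l‖ ^ 2) *
          (ENNReal.ofReal (28 * Real.pi / 3 * x * ε ^ 3) + ENNReal.ofReal (5 * h)) := by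
    intro v
    set e : ℝ := 1 + 2 * ‖v i‖ ^ 2 + ‖v j‖ ^ 2 + ‖v l‖ ^ 2 with he
    set c : ℝ := 28 * Real.pi / 3 * x * ε ^ 3 with hc
    have hc0 : 0 ≤ c := by rw [hc]; positivity
    have he1 : ‖v i - v j‖ ≤ e := by
      rw [he]
      nlinarith [norm_sub_le (v i) (v j), sq_nonneg (‖v i‖ - 1), sq_nonneg (‖v j‖ - 1),
        sq_nonneg ‖v i‖, sq_nonneg ‖v l‖]
    have hp2 : ‖v i - v j‖ ^ 2 ≤ 2 * ‖v i‖ ^ 2 + 2 * ‖v j‖ ^ 2 := by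
      nlinarith [norm_sub_le (v i) (v j), norm_nonneg (v i - v j), sq_nonneg (‖v i‖ - ‖v j‖),
        norm_nonneg (v i), norm_nonneg (v j)]
    have hq2 : ‖v i - v l‖ ^ 2 ≤ 2 * ‖v i‖ ^ 2 + 2 * ‖v l‖ ^ 2 := by
      nlinarith [norm_sub_le (v i) (v l), norm_nonneg (v i - v l), sq_nonneg (‖v i‖ - ‖v l‖),
        norm_nonneg (v i), norm_nonneg (v l)]
    have he2 : ‖v i - v j‖ * ‖v i - v l‖ ≤ e := by
      rw [he]
      nlinarith [sq_nonneg (‖v i - v j‖ - ‖v i - v l‖)]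
    calc Q {y | y j - y i ∈ T v ∧ y l - y i ∈ T' v}
        ≤ 8 * (volume (T v) * volume (T' v)) := by
          rw [hQ, posGibbsMeasure_const_eq_one ha]
          exact htriple _ _ (hTm v) (hT'm v)
      _ ≤ 8 * (ENNReal.ofReal (4 * ε ^ 2 * h * ‖v i - v j‖) *
            (ENNReal.ofReal c + ENNReal.ofReal (5 * (h * ‖v i - v l‖)))) := by
          gcongr
          · exact hTvol v
          · exact hT'vol v
      _ = ENNReal.ofReal (8 * (4 * ε ^ 2 * h * ‖v i - v j‖ * (c + 5 * (h * ‖v i - v l‖)))) := by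
          rw [← ENNReal.ofReal_add hc0 (by positivity), ← ENNReal.ofReal_mul (by positivity),
            ← ENNReal.ofReal_ofNat 8, ← ENNReal.ofReal_mul (by norm_num)]
      _ ≤ ENNReal.ofReal (32 * ε ^ 2 * h * e * (c + 5 * h)) := by
          refine ENNReal.ofReal_le_ofReal ?_
          have h1 : 8 * (4 * ε ^ 2 * h * ‖v i - v j‖ * (c + 5 * (h * ‖v i - v l‖))) =
              32 * ε ^ 2 * h * (c * ‖v i - v j‖ + 5 * h * (‖v i - v j‖ * ‖v i - v l‖)) := by ring
          have h2 : c * ‖v i - v j‖ + 5 * h * (‖v i - v j‖ * ‖v i - v l‖) ≤ c * e + 5 * h * e :=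
            add_le_add (mul_le_mul_of_nonneg_left he1 hc0)
              (mul_le_mul_of_nonneg_left he2 (by positivity))
          have h3 : 32 * ε ^ 2 * h * e * (c + 5 * h) = 32 * ε ^ 2 * h * (c * e + 5 * h * e) := by ring
          rw [h1, h3]
          exact mul_le_mul_of_nonneg_left h2 (by positivity)
      _ = _ := by
          rw [← ENNReal.ofReal_mul (by positivity), ← ENNReal.ofReal_add hc0 (by positivity),
            ← ENNReal.ofReal_mul (by positivity)]
  -- integrate over the velocities
  have hem : Measurable fun v : Fin (N + 1) → V3 =>
      ENNReal.ofReal (1 + 2 * ‖v i‖ ^ 2 + ‖v j‖ ^ 2 + ‖v l‖ ^ 2) := by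
    fun_prop
  calc localGibbsLaw σ (fun _ => a) (fun _ => u) (fun _ => θ) N Φ (E ∩ D)
      = ∫⁻ v, Q ((fun y : Fin (N + 1) → T3 => (y, v)) ⁻¹' (zipConfig ⁻¹' (E ∩ D))) ∂Γ := by
        rw [hlaw, Measure.map_apply measurable_zipConfig (hEm.inter hDm),
          Measure.prod_apply_symm (measurable_zipConfig (hEm.inter hDm))]
    _ ≤ ∫⁻ v, ENNReal.ofReal (32 * ε ^ 2 * h) *
          ENNReal.ofReal (1 + 2 * ‖v i‖ ^ 2 + ‖v j‖ ^ 2 + ‖v l‖ ^ 2) *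
            (ENNReal.ofReal (28 * Real.pi / 3 * x * ε ^ 3) + ENNReal.ofReal (5 * h)) ∂Γ := by
        refine lintegral_mono fun v => ?_
        rw [hsec v]
        exact hpt v
    _ = _ := by
        rw [lintegral_mul_const _ (hem.const_mul _), lintegral_const_mul _ hem, hΓ,
          lintegral_velWeight_pi_gaussMeasure u hθ i j l]

end Summit.AtomisticToContinuum.HydrodynamicLimit.Theorems.EvenStressEnskog

end
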